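import Mathlib
import HarnessLib
import Summits.Ventures.LatticeQCDFlow.Scoring.SectorLinearLaw
import Summits.Ventures.LatticeQCDFlow.Scoring.ChainTimeAverage
import Summits.Ventures.LatticeQCDFlow.Scoring.VarianceOfTheMean

/-!
# A frozen run does not average — and looks converged: if `ρ_f(t) ≥ 1 − θt` then the stationary time
# average of `N` samples has `Var[f̄_N] ≥ Var_π f·(1 − θ(N²−1)/(3N))` and the expected sample variance is
# `≤ θ Var_π f (N²−1)/(3N)`; for a sector of ANY exact sampler `Var[Â_N] ≥ a(1−a) − Φ(N²−1)/(3N)`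

HONEST FRAMING: exact (Metropolis-corrected) sampling algorithms for lattice gauge theory;
figures of merit are autocorrelation/cost numbers at stated couplings and volumes; no
continuum-physics claim.

Venture `LatticeQCDFlow` (cell pub-lqcd), topic `Scoring`; FANOUT row 8 (`s0-cpn-nemc`, GEN-23).
NEW WORK of the cell, not a published result; no definition is introduced; nothing is cited as a
fact.  Composed from built facts of the tree: row 11's EXACT finite-`N` variance of the mean
`Var[f̄_N] = 2 τ_N(ρ_f) Var_π f / N`, `τ_N(ρ) = ½ + Σ_{t<N} (1 − (t+1)/N) ρ(t+1)`
(`Scoring/VarianceOfTheMean.tauIntN`, `Scoring/ChainTimeAverage.variance_timeAverage`: the stationary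
chain of any `π`-invariant Markov kernel on path space) and this row's sector LINEAR LAW
`ρ_t(1_A) ≥ 1 − tΦ/(a(1−a))` for every exact sampler, reversible or not
(`Scoring/SectorLinearLaw.acf_centredIndicator_ge_linear`; `a = π(A)`, `Φ = (π ⊗ₘ κ)(A ×ˢ Aᶜ)` the
stationary exit flux).  RESULTS: (1) ABSTRACT: `ρ(t) ≥ 1 − θt` for `1 ≤ t ≤ N` ⇒
`τ_N(ρ) ≥ N/2 − θ(N²−1)/6`, i.e. the variance factor `2τ_N/N ≥ 1 − θ(N²−1)/(3N)`; (2) ON PATH SPACE,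
any bounded `f` with `Var_π f ≠ 0` and `ρ_f(t) ≥ 1 − θt`: **`Var[f̄_N] ≥ Var_π f − θ Var_π f (N²−1)/(3N)`**
(averaging `N ≪ 3/θ` successive samples of a frozen observable gains nothing to leading order); (3) SECTORS:
the fraction of time `Â_N` spent in a sector (`0 < a < 1`) has **`Var[Â_N] ≥ a(1−a) − Φ(N²−1)/(3N)`**;
(4) TYPED INSTANCES: theory-2's separating set `S` for the charge `Q` along the a.s.-allowed move
relation (`Scaling/TunnellingLaws`; `Φ ≤ 2π(S)` for `A = {Q ∈ U}`) and the exact flow sampler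
`indepMH q w` (`Φ ≤ π(A)q(Aᶜ)`: under mode collapse a run of length `N ≪ 3(1−a)/q(Aᶜ)` estimates the
sector weight as noisily as ONE sample); (5) THE RUN LOOKS CONVERGED: the stationary expectation of
the SAMPLE VARIANCE `v̂_N = (1/N)Σ f(X_t)² − f̄_N²` is `Var_π f − Var[f̄_N] ≤ θ Var_π f (N²−1)/(3N)`
(sectors: `≤ Φ(N²−1)/(3N)` against the equilibrium `a(1−a)`; the covariance-structure form of the
identity is `Scoring/NaiveErrorBar.integral_naiveSEsq_eq`).  Companions: `Scoring/SectorLinearLaw(Windows)`,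
`Scoring/RareChangeAutocorrelation`, `Scoring/SectorBottleneckFloor`.  NAMED ONLY: Priestley 1981; Sokal 1997.

## Content

`sum_range_weight_linear`, **`tauIntN_ge_of_acf_linear`**, `varianceFactor_ge_of_acf_linear` (1);
**`variance_timeAverage_ge_of_acf_linear`** (2); **`variance_timeAverage_sector_ge`**, `…_of_flux_le` (3);
`variance_timeAverage_sector_ge_of_separating`, `indepMH_variance_timeAverage_sector_ge` (4);
**`chain_integral_sampleVariance_eq`**, `…_le_of_acf_linear`, **`chain_integral_sampleVariance_sector_le`** (5).
NOT CLAIMED: upper bounds on `Var[f̄_N]`; non-stationary starts; the size of `Φ` for any sampler; numbers.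
-/

noncomputable section

namespace Summit.Ventures.LatticeQCDFlow.Scoring

open MeasureTheory ProbabilityTheory Filter Finset Summit.Ventures.LatticeQCDFlow.Exactness
open scoped ENNReal

variable {Ω : Type*} [MeasurableSpace Ω]

/-! ### §1 The triangular window under a linear autocorrelation floor -/

section Abstract

/-- `Σ_{t<M} (c − (t+1))(1 − θ(t+1))` in closed form (power sums). -/
theorem sum_range_sub_mul_linear (c θ : ℝ) : ∀ M : ℕ,
    ∑ t ∈ range M, (c - ((t : ℝ) + 1)) * (1 - θ * ((t : ℝ) + 1))
      = c * M - (M : ℝ) * (M + 1) / 2 - θ * c * ((M : ℝ) * (M + 1) / 2)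
        + θ * ((M : ℝ) * (M + 1) * (2 * M + 1) / 6)
  | 0 => by simp
  | M + 1 => by
    rw [Finset.sum_range_succ, sum_range_sub_mul_linear c θ M]
    push_cast
    ring

/-- **`Σ_{t<N} (1 − (t+1)/N)(1 − θ(t+1)) = (N − 1)/2 − θ(N² − 1)/6`** for `N ≠ 0`. -/
theorem sum_range_weight_linear (θ : ℝ) {N : ℕ} (hN : N ≠ 0) :
    ∑ t ∈ range N, (1 - ((t : ℝ) + 1) / N) * (1 - θ * ((t : ℝ) + 1))
      = ((N : ℝ) - 1) / 2 - θ * ((N : ℝ) ^ 2 - 1) / 6 := by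
  have hN' : (N : ℝ) ≠ 0 := by exact_mod_cast hN
  have hscale : ∑ t ∈ range N, (1 - ((t : ℝ) + 1) / N) * (1 - θ * ((t : ℝ) + 1))
      = (1 / (N : ℝ)) * ∑ t ∈ range N, ((N : ℝ) - ((t : ℝ) + 1)) * (1 - θ * ((t : ℝ) + 1)) := by
    rw [Finset.mul_sum]
    refine Finset.sum_congr rfl fun t _ => ?_
    field_simp
  rw [hscale, sum_range_sub_mul_linear]
  field_simp
  ring

/-- **THE TRIANGULAR WINDOW UNDER A LINEAR FLOOR**: `ρ(t) ≥ 1 − θt` for `1 ≤ t ≤ N` (`N ≠ 0`) gives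
`τ_N(ρ) ≥ N/2 − θ(N² − 1)/6`. -/
theorem tauIntN_ge_of_acf_linear {ρ : ℕ → ℝ} {θ : ℝ} {N : ℕ} (hN : N ≠ 0)
    (hρ : ∀ t : ℕ, 1 ≤ t → t ≤ N → 1 - θ * t ≤ ρ t) :
    (N : ℝ) / 2 - θ * ((N : ℝ) ^ 2 - 1) / 6 ≤ tauIntN ρ N := by
  unfold tauIntN
  have hNpos : (0 : ℝ) < N := by exact_mod_cast Nat.pos_of_ne_zero hN
  have hterm : ∀ t ∈ range N,
      (1 - ((t : ℝ) + 1) / N) * (1 - θ * ((t : ℝ) + 1)) ≤ (1 - ((t : ℝ) + 1) / N) * ρ (t + 1) := by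
    intro t ht
    have htN : t + 1 ≤ N := Finset.mem_range.mp ht
    have hw : 0 ≤ 1 - ((t : ℝ) + 1) / N := by
      rw [sub_nonneg, div_le_one hNpos]
      exact_mod_cast htN
    have h := hρ (t + 1) (Nat.le_add_left 1 t) htN
    push_cast at h
    exact mul_le_mul_of_nonneg_left h hw
  have hsum := Finset.sum_le_sum hterm
  rw [sum_range_weight_linear θ hN] at hsum
  linarith

/-- The VARIANCE FACTOR: `1 − θ(N² − 1)/(3N) ≤ 2 τ_N(ρ)/N` under the same floor. -/
theorem varianceFactor_ge_of_acf_linear {ρ : ℕ → ℝ} {θ : ℝ} {N : ℕ} (hN : N ≠ 0)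
    (hρ : ∀ t : ℕ, 1 ≤ t → t ≤ N → 1 - θ * t ≤ ρ t) :
    1 - θ * ((N : ℝ) ^ 2 - 1) / (3 * N) ≤ 2 * tauIntN ρ N / N := by
  have hNpos : (0 : ℝ) < N := by exact_mod_cast Nat.pos_of_ne_zero hN
  have h := tauIntN_ge_of_acf_linear hN hρ
  rw [le_div_iff₀ hNpos]
  have e : (1 - θ * ((N : ℝ) ^ 2 - 1) / (3 * N)) * N = 2 * ((N : ℝ) / 2 - θ * ((N : ℝ) ^ 2 - 1) / 6) := by
    field_simp
    ring
  rw [e]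
  linarith

end Abstract

/-! ### §2 On path space: the stationary time average of a frozen observable -/

section Chain

variable {κ : Kernel Ω Ω} [IsMarkovKernel κ] {π : Measure Ω} [IsProbabilityMeasure π]

/-- **A FROZEN OBSERVABLE DOES NOT AVERAGE**: `π` invariant, `|f| ≤ C` measurable, `Var_π f ≠ 0`, and
`ρ_f(t) ≥ 1 − θt` for `1 ≤ t ≤ N` (`N ≠ 0`).  Then the stationary chain's time average satisfies
`Var_π f − θ Var_π f (N² − 1)/(3N) ≤ Var[f̄_N]`. -/
theorem variance_timeAverage_ge_of_acf_linear (hπ : Kernel.Invariant κ π) {f : Ω → ℝ}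
    (hf : Measurable f) {C : ℝ} (hC : ∀ x, |f x| ≤ C) {N : ℕ} (hN : N ≠ 0)
    (hvar : autocov κ π (fun y => f y - ∫ z, f z ∂π) 0 ≠ 0) {θ : ℝ}
    (hρ : ∀ t : ℕ, 1 ≤ t → t ≤ N → 1 - θ * t
      ≤ autocov κ π (fun y => f y - ∫ z, f z ∂π) t / autocov κ π (fun y => f y - ∫ z, f z ∂π) 0) :
    autocov κ π (fun y => f y - ∫ z, f z ∂π) 0
        - θ * autocov κ π (fun y => f y - ∫ z, f z ∂π) 0 * ((N : ℝ) ^ 2 - 1) / (3 * N)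
      ≤ Var[fun x : ℕ → Ω => (∑ i ∈ range N, f (x i)) / N;
          Kernel.trajMeasure (X := fun _ : ℕ => Ω) π
            (fun n : ℕ => κ.comap (fun h : (i : ↥(Finset.Iic n)) → Ω => h ⟨n, Finset.mem_Iic.2 le_rfl⟩)
              (measurable_pi_apply _))] := by
  set V := autocov κ π (fun y => f y - ∫ z, f z ∂π) 0 with hV
  have hVnn : 0 ≤ V := by
    rw [hV, autocov_zero]
    exact integral_nonneg fun y => by positivity
  have hVpos : 0 < V := lt_of_le_of_ne hVnn (Ne.symm hvar)
  have hNpos : (0 : ℝ) < N := by exact_mod_cast Nat.pos_of_ne_zero hN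
  rw [variance_timeAverage hπ hf hC hN hvar]
  have hfac := varianceFactor_ge_of_acf_linear hN hρ
  have e : 2 * tauIntN (fun t => autocov κ π (fun y => f y - ∫ z, f z ∂π) t / V) N * V / N
      = (2 * tauIntN (fun t => autocov κ π (fun y => f y - ∫ z, f z ∂π) t / V) N / N) * V := by
    ring
  rw [e]
  have e2 : V - θ * V * ((N : ℝ) ^ 2 - 1) / (3 * N) = (1 - θ * ((N : ℝ) ^ 2 - 1) / (3 * N)) * V := by
    ring
  rw [e2]
  exact mul_le_mul_of_nonneg_right hfac hVnn

end Chain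

/-! ### §3 Sectors of any exact sampler -/

section Sector

variable {κ : Kernel Ω Ω} [IsMarkovKernel κ] {π : Measure Ω} [IsProbabilityMeasure π] {A : Set Ω}

/-- **THE SECTOR-WEIGHT ESTIMATE OF A FROZEN RUN**: `π` invariant (no reversibility), `A` measurable
with `0 < a = π(A) < 1`, `Φ = ((π ⊗ₘ κ)(A ×ˢ Aᶜ)).toReal`, `N ≠ 0`.  The fraction of time the stationary
chain spends in `A` over `N` steps has `Var[Â_N] ≥ a(1−a) − Φ(N² − 1)/(3N)`. -/
theorem variance_timeAverage_sector_ge (hπ : Kernel.Invariant κ π) (hA : MeasurableSet A)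
    (ha0 : 0 < π.real A) (ha1 : π.real A < 1) {N : ℕ} (hN : N ≠ 0) :
    π.real A * (1 - π.real A) - ((π ⊗ₘ κ) (A ×ˢ Aᶜ)).toReal * ((N : ℝ) ^ 2 - 1) / (3 * N)
      ≤ Var[fun x : ℕ → Ω => (∑ i ∈ range N, A.indicator (1 : Ω → ℝ) (x i)) / N;
          Kernel.trajMeasure (X := fun _ : ℕ => Ω) π
            (fun n : ℕ => κ.comap (fun h : (i : ↥(Finset.Iic n)) → Ω => h ⟨n, Finset.mem_Iic.2 le_rfl⟩)
              (measurable_pi_apply _))] := by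
  have hvarA : 0 < π.real A * (1 - π.real A) := mul_pos ha0 (by linarith)
  have h1m : Measurable (A.indicator (1 : Ω → ℝ)) := measurable_const.indicator hA
  have h1b : ∀ x, |A.indicator (1 : Ω → ℝ) x| ≤ 1 := fun x => by
    by_cases hx : x ∈ A <;> simp [hx]
  have hmean : ∫ z, A.indicator (1 : Ω → ℝ) z ∂π = π.real A := integral_indicator_one hA
  have h0 : autocov κ π (fun y => A.indicator (1 : Ω → ℝ) y - ∫ z, A.indicator (1 : Ω → ℝ) z ∂π) 0
      = π.real A * (1 - π.real A) := by
    rw [hmean]; exact autocov_centredIndicator_zero hA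
  have hvar : autocov κ π
      (fun y => A.indicator (1 : Ω → ℝ) y - ∫ z, A.indicator (1 : Ω → ℝ) z ∂π) 0 ≠ 0 := by
    rw [h0]; exact hvarA.ne'
  set Φ := ((π ⊗ₘ κ) (A ×ˢ Aᶜ)).toReal with hΦ
  have hρ : ∀ t : ℕ, 1 ≤ t → t ≤ N → 1 - Φ / (π.real A * (1 - π.real A)) * t
      ≤ autocov κ π (fun y => A.indicator (1 : Ω → ℝ) y - ∫ z, A.indicator (1 : Ω → ℝ) z ∂π) t
          / autocov κ π (fun y => A.indicator (1 : Ω → ℝ) y - ∫ z, A.indicator (1 : Ω → ℝ) z ∂π) 0 := by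
    intro t _ _
    rw [hmean]
    have h := acf_centredIndicator_ge_linear hπ hA ha0 ha1 t
    have e : Φ / (π.real A * (1 - π.real A)) * t = t * Φ / (π.real A * (1 - π.real A)) := by ring
    rw [e]
    exact h
  have h := variance_timeAverage_ge_of_acf_linear hπ h1m h1b hN hvar hρ
  rw [h0, div_mul_cancel₀ Φ hvarA.ne'] at h
  exact h

/-- The same with an external flux bound `(π ⊗ₘ κ)(A ×ˢ Aᶜ) ≤ T < ∞` (a tunnelling law):
`Var[Â_N] ≥ a(1−a) − T(N² − 1)/(3N)`. -/
theorem variance_timeAverage_sector_ge_of_flux_le (hπ : Kernel.Invariant κ π)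
    (hA : MeasurableSet A) (ha0 : 0 < π.real A) (ha1 : π.real A < 1) {N : ℕ} (hN : N ≠ 0)
    {T : ℝ≥0∞} (hT : (π ⊗ₘ κ) (A ×ˢ Aᶜ) ≤ T) (hTtop : T ≠ ⊤) :
    π.real A * (1 - π.real A) - T.toReal * ((N : ℝ) ^ 2 - 1) / (3 * N)
      ≤ Var[fun x : ℕ → Ω => (∑ i ∈ range N, A.indicator (1 : Ω → ℝ) (x i)) / N;
          Kernel.trajMeasure (X := fun _ : ℕ => Ω) π
            (fun n : ℕ => κ.comap (fun h : (i : ↥(Finset.Iic n)) → Ω => h ⟨n, Finset.mem_Iic.2 le_rfl⟩)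
              (measurable_pi_apply _))] := by
  have h := variance_timeAverage_sector_ge hπ hA ha0 ha1 hN
  have hle : ((π ⊗ₘ κ) (A ×ˢ Aᶜ)).toReal ≤ T.toReal := ENNReal.toReal_mono hTtop hT
  have hN1 : (1 : ℝ) ≤ N := by exact_mod_cast Nat.one_le_iff_ne_zero.mpr hN
  have hmono : ((π ⊗ₘ κ) (A ×ˢ Aᶜ)).toReal * ((N : ℝ) ^ 2 - 1) / (3 * N)
      ≤ T.toReal * ((N : ℝ) ^ 2 - 1) / (3 * N) :=
    div_le_div_of_nonneg_right (mul_le_mul_of_nonneg_right hle (by nlinarith)) (by positivity)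
  linarith

end Sector

/-! ### §4 Typed instances -/

section Separating

variable {κ : Kernel Ω Ω} [IsMarkovKernel κ] {π : Measure Ω} [IsProbabilityMeasure π]
  {ι : Type*} {R : Ω → Ω → Prop} {Q : Ω → ι} {S : Set Ω} {U : Set ι}

/-- **TOPOLOGICAL FREEZING OF THE SECTOR-WEIGHT ESTIMATE, TYPED** (theory-2's setting, no
reversibility): `S` separates `Q` along the a.s.-allowed relation `R`, `π` invariant; for
`A = {Q ∈ U}` with `0 < a < 1`: `Var[Â_N] ≥ a(1−a) − 2π(S)(N² − 1)/(3N)`. -/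
theorem variance_timeAverage_sector_ge_of_separating
    (hS : ∀ ⦃x y⦄, R x y → Q x ≠ Q y → x ∈ S ∨ y ∈ S)
    (hπ : Kernel.Invariant κ π) (hR : ∀ᵐ q ∂(π ⊗ₘ κ), R q.1 q.2) (hA : MeasurableSet (Q ⁻¹' U))
    (ha0 : 0 < π.real (Q ⁻¹' U)) (ha1 : π.real (Q ⁻¹' U) < 1) {N : ℕ} (hN : N ≠ 0) :
    π.real (Q ⁻¹' U) * (1 - π.real (Q ⁻¹' U)) - 2 * π.real S * ((N : ℝ) ^ 2 - 1) / (3 * N)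
      ≤ Var[fun x : ℕ → Ω => (∑ i ∈ range N, (Q ⁻¹' U).indicator (1 : Ω → ℝ) (x i)) / N;
          Kernel.trajMeasure (X := fun _ : ℕ => Ω) π
            (fun n : ℕ => κ.comap (fun h : (i : ↥(Finset.Iic n)) → Ω => h ⟨n, Finset.mem_Iic.2 le_rfl⟩)
              (measurable_pi_apply _))] := by
  have hsub : (Q ⁻¹' U) ×ˢ (Q ⁻¹' U)ᶜ ⊆ {p : Ω × Ω | Q p.1 ≠ Q p.2} := by
    rintro ⟨x, y⟩ ⟨hx, hy⟩ hq
    exact hy (by simpa [Set.mem_preimage, ← hq] using hx)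
  have hT : (π ⊗ₘ κ) ((Q ⁻¹' U) ×ˢ (Q ⁻¹' U)ᶜ) ≤ 2 * π S :=
    (measure_mono hsub).trans (Theory2.Tunnelling.compProd_chargeChange_le_of_invariant hS π κ hπ hR)
  have h := variance_timeAverage_sector_ge_of_flux_le hπ hA ha0 ha1 hN hT
    (ENNReal.mul_ne_top ENNReal.ofNat_ne_top (measure_ne_top π S))
  rwa [ENNReal.toReal_mul, ENNReal.toReal_ofNat, ← measureReal_def] at h

end Separating

section ModeCollapse

variable {q : Measure Ω} [IsProbabilityMeasure q] {w : Ω → ℝ} {π : Measure Ω}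
  [IsProbabilityMeasure π] {A : Set Ω}

/-- **MODE COLLAPSE MAKES THE RUN AS NOISY AS ONE SAMPLE** (exact flow-MCMC kernel `indepMH q w`,
target `π = w·q`, `Fact (Measurable w)` in scope for the path-space law): for a sector with
`0 < a < 1`, `Var[Â_N] ≥ a(1−a) − a·q(Aᶜ)(N² − 1)/(3N)`. -/
theorem indepMH_variance_timeAverage_sector_ge [hmw : Fact (Measurable w)] (hw0 : ∀ x, 0 < w x)
    (hπ : (q.withDensity fun x => ENNReal.ofReal (w x)) = π) (hA : MeasurableSet A)
    (ha0 : 0 < π.real A) (ha1 : π.real A < 1) {N : ℕ} (hN : N ≠ 0) :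
    π.real A * (1 - π.real A) - π.real A * q.real Aᶜ * ((N : ℝ) ^ 2 - 1) / (3 * N)
      ≤ Var[fun x : ℕ → Ω => (∑ i ∈ range N, A.indicator (1 : Ω → ℝ) (x i)) / N;
          Kernel.trajMeasure (X := fun _ : ℕ => Ω) π
            (fun n : ℕ => (indepMH q w).comap
              (fun h : (i : ↥(Finset.Iic n)) → Ω => h ⟨n, Finset.mem_Iic.2 le_rfl⟩)
              (measurable_pi_apply _))] := by
  have hw : Measurable w := hmw.out
  have hrev : Kernel.IsReversible (indepMH q w) π := by
    rw [← hπ]; exact indepMH_isReversible hw hw0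
  have h := variance_timeAverage_sector_ge_of_flux_le hrev.invariant hA ha0 ha1 hN
    (indepMH_flux_le hw hA) (ENNReal.mul_ne_top (measure_ne_top π A) (measure_ne_top q Aᶜ))
  rwa [ENNReal.toReal_mul, ← measureReal_def, ← measureReal_def] at h

end ModeCollapse

/-! ### §5 The run looks converged: the expected sample variance of a frozen observable is small -/

section SampleVariance

variable {κ : Kernel Ω Ω} [IsMarkovKernel κ] {π : Measure Ω} [IsProbabilityMeasure π]

/-- **`E_π[v̂_N] = Var_π f − Var[f̄_N]`** for the stationary chain (`π` invariant, `|f| ≤ C` measurable,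
`N ≠ 0`): the sample variance `v̂_N = (1/N) Σ_{t<N} f(X_t)² − f̄_N²` of `N` successive measurements has
expectation the equilibrium variance MINUS the variance of the time average. -/
theorem chain_integral_sampleVariance_eq (hπ : Kernel.Invariant κ π) {f : Ω → ℝ}
    (hf : Measurable f) {C : ℝ} (hC : ∀ x, |f x| ≤ C) {N : ℕ} (hN : N ≠ 0) :
    ∫ x, ((∑ t ∈ range N, f (x t) ^ 2) / (N : ℝ) - ((∑ t ∈ range N, f (x t)) / (N : ℝ)) ^ 2)
        ∂(Kernel.trajMeasure (X := fun _ : ℕ => Ω) π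
          (fun n : ℕ => κ.comap (fun h : (i : ↥(Finset.Iic n)) → Ω => h ⟨n, Finset.mem_Iic.2 le_rfl⟩)
            (measurable_pi_apply _)))
      = ∫ z, (f z - ∫ z', f z' ∂π) ^ 2 ∂π
        - Var[fun x : ℕ → Ω => (∑ t ∈ range N, f (x t)) / N;
          Kernel.trajMeasure (X := fun _ : ℕ => Ω) π
            (fun n : ℕ => κ.comap (fun h : (i : ↥(Finset.Iic n)) → Ω => h ⟨n, Finset.mem_Iic.2 le_rfl⟩)
              (measurable_pi_apply _))] := by
  set P := Kernel.trajMeasure (X := fun _ : ℕ => Ω) π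
      (fun n : ℕ => κ.comap (fun h : (i : ↥(Finset.Iic n)) → Ω => h ⟨n, Finset.mem_Iic.2 le_rfl⟩)
        (measurable_pi_apply _)) with hP
  have hNpos : (0 : ℝ) < N := by exact_mod_cast Nat.pos_of_ne_zero hN
  have hsqb : ∀ y, |f y ^ 2| ≤ C ^ 2 := fun y => by
    rw [abs_pow]; exact pow_le_pow_left₀ (abs_nonneg _) (hC y) 2
  have hsq_i : ∀ t, Integrable (fun x : ℕ → Ω => f (x t) ^ 2) P := fun t =>
    integrable_of_bounded P ((hf.comp (measurable_pi_apply t)).pow_const 2) fun x => hsqb (x t)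
  have hf_i : ∀ t, Integrable (fun x : ℕ → Ω => f (x t)) P := fun t =>
    integrable_of_bounded P (hf.comp (measurable_pi_apply t)) fun x => hC (x t)
  have hmean_m : Measurable fun x : ℕ → Ω => (∑ t ∈ range N, f (x t)) / (N : ℝ) :=
    (Finset.measurable_sum _ fun t _ => hf.comp (measurable_pi_apply t)).div_const _
  have hmean_b : ∀ x : ℕ → Ω, |(∑ t ∈ range N, f (x t)) / (N : ℝ)| ≤ C := by
    intro x
    rw [abs_div, abs_of_pos hNpos, div_le_iff₀ hNpos]
    calc |∑ t ∈ range N, f (x t)| ≤ ∑ t ∈ range N, |f (x t)| := Finset.abs_sum_le_sum_abs _ _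
      _ ≤ ∑ t ∈ range N, C := Finset.sum_le_sum fun t _ => hC _
      _ = C * N := by rw [Finset.sum_const, Finset.card_range, nsmul_eq_mul, mul_comm]
  have hmean_L2 : MemLp (fun x : ℕ → Ω => (∑ t ∈ range N, f (x t)) / (N : ℝ)) 2 P :=
    MemLp.of_bound hmean_m.aestronglyMeasurable C
      (ae_of_all _ fun x => by rw [Real.norm_eq_abs]; exact hmean_b x)
  have hmean_sq_i : Integrable (fun x : ℕ → Ω => ((∑ t ∈ range N, f (x t)) / (N : ℝ)) ^ 2) P :=
    hmean_L2.integrable_sq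
  have hsum_i : Integrable (fun x : ℕ → Ω => (∑ t ∈ range N, f (x t) ^ 2) / (N : ℝ)) P :=
    (integrable_finsetSum (range N) fun t _ => hsq_i t).div_const _
  -- the three expectations
  have h1 : ∫ x, (∑ t ∈ range N, f (x t) ^ 2) / (N : ℝ) ∂P = ∫ z, f z ^ 2 ∂π := by
    rw [integral_div, integral_finsetSum _ fun t _ => hsq_i t]
    have e : ∀ t ∈ range N, ∫ x, f (x t) ^ 2 ∂P = ∫ z, f z ^ 2 ∂π := fun t _ =>
      chain_marginal hπ t (hf.pow_const 2) hsqb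
    rw [Finset.sum_congr rfl e, Finset.sum_const, Finset.card_range, nsmul_eq_mul]
    field_simp
  have h2 : ∫ x, (∑ t ∈ range N, f (x t)) / (N : ℝ) ∂P = ∫ z, f z ∂π := by
    rw [integral_div, integral_finsetSum _ fun t _ => hf_i t]
    have e : ∀ t ∈ range N, ∫ x, f (x t) ∂P = ∫ z, f z ∂π := fun t _ => chain_marginal hπ t hf hC
    rw [Finset.sum_congr rfl e, Finset.sum_const, Finset.card_range, nsmul_eq_mul]
    field_simp
  have h3 : Var[fun x : ℕ → Ω => (∑ t ∈ range N, f (x t)) / N; P]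
      = ∫ x, ((∑ t ∈ range N, f (x t)) / (N : ℝ)) ^ 2 ∂P - (∫ z, f z ∂π) ^ 2 := by
    have h := variance_eq_sub hmean_L2
    simp only [Pi.pow_apply] at h
    rw [h, h2]
  have h4 : ∫ z, (f z - ∫ z', f z' ∂π) ^ 2 ∂π = ∫ z, f z ^ 2 ∂π - (∫ z, f z ∂π) ^ 2 := by
    have hfi : Integrable f π := integrable_of_bounded π hf hC
    have hf2i : Integrable (fun z => f z ^ 2) π := integrable_of_bounded π (hf.pow_const 2) hsqb
    set m := ∫ z', f z' ∂π with hm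
    have e : (fun z => (f z - m) ^ 2) = fun z => f z ^ 2 - (2 * m) * f z + m ^ 2 := by funext z; ring
    have hI : Integrable (fun z => f z ^ 2 - (2 * m) * f z) π := hf2i.sub (hfi.const_mul _)
    rw [e, integral_add hI (integrable_const _), integral_sub hf2i (hfi.const_mul _),
      integral_const_mul, integral_const, probReal_univ, one_smul, ← hm]
    ring
  rw [integral_sub hsum_i hmean_sq_i, h1, h3, h4]
  ring

/-- **THE RUN LOOKS CONVERGED**: `π` invariant, `|f| ≤ C` measurable, `Var_π f ≠ 0`, `N ≠ 0`, and
`ρ_f(t) ≥ 1 − θt` for `1 ≤ t ≤ N` ⇒ **`E_π[v̂_N] ≤ θ Var_π f (N² − 1)/(3N)`**: the sample variance a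
frozen run shows is a vanishing fraction of the equilibrium variance while `N ≪ 3/θ`. -/
theorem chain_integral_sampleVariance_le_of_acf_linear (hπ : Kernel.Invariant κ π) {f : Ω → ℝ}
    (hf : Measurable f) {C : ℝ} (hC : ∀ x, |f x| ≤ C) {N : ℕ} (hN : N ≠ 0)
    (hvar : autocov κ π (fun y => f y - ∫ z, f z ∂π) 0 ≠ 0) {θ : ℝ}
    (hρ : ∀ t : ℕ, 1 ≤ t → t ≤ N → 1 - θ * t
      ≤ autocov κ π (fun y => f y - ∫ z, f z ∂π) t / autocov κ π (fun y => f y - ∫ z, f z ∂π) 0) :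
    ∫ x, ((∑ t ∈ range N, f (x t) ^ 2) / (N : ℝ) - ((∑ t ∈ range N, f (x t)) / (N : ℝ)) ^ 2)
        ∂(Kernel.trajMeasure (X := fun _ : ℕ => Ω) π
          (fun n : ℕ => κ.comap (fun h : (i : ↥(Finset.Iic n)) → Ω => h ⟨n, Finset.mem_Iic.2 le_rfl⟩)
            (measurable_pi_apply _)))
      ≤ θ * autocov κ π (fun y => f y - ∫ z, f z ∂π) 0 * ((N : ℝ) ^ 2 - 1) / (3 * N) := by
  rw [chain_integral_sampleVariance_eq hπ hf hC hN]
  have h := variance_timeAverage_ge_of_acf_linear hπ hf hC hN hvar hρ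
  have e : ∫ z, (f z - ∫ z', f z' ∂π) ^ 2 ∂π = autocov κ π (fun y => f y - ∫ z, f z ∂π) 0 := by
    rw [autocov_zero]
  rw [e]
  linarith

variable {A : Set Ω}

/-- **A FROZEN SECTOR LOOKS DECIDED**: for a sector with `0 < a < 1` of ANY exact sampler, the
stationary run's sample variance of the indicator has `E_π[v̂_N(1_A)] ≤ Φ(N² − 1)/(3N)` although the
equilibrium variance is `a(1−a)` (`Φ = ((π ⊗ₘ κ)(A ×ˢ Aᶜ)).toReal`, `N ≠ 0`). -/
theorem chain_integral_sampleVariance_sector_le (hπ : Kernel.Invariant κ π) (hA : MeasurableSet A)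
    (ha0 : 0 < π.real A) (ha1 : π.real A < 1) {N : ℕ} (hN : N ≠ 0) :
    ∫ x, ((∑ t ∈ range N, A.indicator (1 : Ω → ℝ) (x t) ^ 2) / (N : ℝ)
        - ((∑ t ∈ range N, A.indicator (1 : Ω → ℝ) (x t)) / (N : ℝ)) ^ 2)
        ∂(Kernel.trajMeasure (X := fun _ : ℕ => Ω) π
          (fun n : ℕ => κ.comap (fun h : (i : ↥(Finset.Iic n)) → Ω => h ⟨n, Finset.mem_Iic.2 le_rfl⟩)
            (measurable_pi_apply _)))
      ≤ ((π ⊗ₘ κ) (A ×ˢ Aᶜ)).toReal * ((N : ℝ) ^ 2 - 1) / (3 * N) := by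
  have h1m : Measurable (A.indicator (1 : Ω → ℝ)) := measurable_const.indicator hA
  have h1b : ∀ x, |A.indicator (1 : Ω → ℝ) x| ≤ 1 := fun x => by
    by_cases hx : x ∈ A <;> simp [hx]
  rw [chain_integral_sampleVariance_eq hπ h1m h1b hN]
  have h := variance_timeAverage_sector_ge hπ hA ha0 ha1 hN
  have e : ∫ z, (A.indicator (1 : Ω → ℝ) z - ∫ z', A.indicator (1 : Ω → ℝ) z' ∂π) ^ 2 ∂π
      = π.real A * (1 - π.real A) := by
    rw [integral_indicator_one hA, ← autocov_zero κ, autocov_centredIndicator_zero hA]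
  rw [e]
  linarith

end SampleVariance

end Summit.Ventures.LatticeQCDFlow.Scoring

end
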